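import Summits.QuantumFields.BalabanUV.T4Continuum.Support.NE9B11ChartAnalytic
import Literature.MathematicalPhysics.QuantumFieldTheory.Balaban1983to89.B11Eq118RegimeRadii
import Literature.MathematicalPhysics.QuantumFieldTheory.Balaban1983to89.B11Eq44CLetterTower
import Literature.MathematicalPhysics.QuantumFieldTheory.Balaban1983to89.B9Thm311SmallFieldCoercivityTower
import Literature.MathematicalPhysics.QuantumFieldTheory.Balaban1983to89.B9Eq315QTowerLipschitz
import Literature.MathematicalPhysics.QuantumFieldTheory.Balaban1983to89.B7Eq43AveragedSmallness

/-!
# NE9CurChartTower — THE CHART OF THE CURVE SPECIES `cur U` FOR PRINT'S `k`-TH-STEP OPERATOR: lit-balaban's chart (174)∘(47) at the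
# `k`-LEVEL letters `𝔊_k(U)`, `H_{1,k}(U)` of [Balaban1985BackgroundPropagators] (3.26)∕(3.126) with the COMPOSITE averagings `Q_k(U)`, `Q′_k(U)`
# of (3.15)∕(3.19) (`B9Eq326OperatorTower`, this lineage gen 78) and the `k`-level Sect. C letter `C_k` of [Balaban1985Variational] (44) (NE9 leaf-03's
# `B11Eq44CLetterTower`) EXISTS AS AN ANALYTIC OBJECT ON A BALL — §1 modulo the displayed positivity `hpos` (E167), §2 with `hpos` PRODUCED at every
# unitary small-bond background of a fixed lattice by this generation's `B9Thm311SmallFieldCoercivityTower` modulo the TOWER averaging letters;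
# cell `pub-balaban`, T4-DAG §2 node U3 ∕ §6 NE9, route R2′ of `t4/ROUTES-NE9.md`; BINDER row NE9 OWNER lineage `b2b-balaban-t4-ne9-p1`, generation 83;
# Summits-side NEW leaf under this seat's INTERFACE REQUEST NE9 #4 of this generation (the one-step host `Support/NE9CurChartOfBackground` is 345+ l.,
# the 400-line rule); nothing printed asserted

HONEST FRAMING (T4-DAG PAGE 1).  Rung (B)+1 of the FINITE-VOLUME T⁴ programme — NOT infinite volume, NOT a mass gap, NOT the Clay problem.  NE9 is a
cell NEW ESTIMATE, NOT PRINTED in [Balaban1987RG1] ∕ [Balaban1988RG2Cluster], and NOT PROVED here («NE9 ⇐ the named binders»; spine PROVED 0∕9).  HONEST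
DEPENDENCY (cell line, verbatim): continuum YM on T⁴ ⇐ BetaPertH ∧ nine spine estimates (0/9 proved); BetaPertH ⇐ (D1) ∧ (D4) ∧ CAP+tail; G-an2-4
gates asym, D1 and NE2/3/4.  The `cur U` OBJECT is ONE item of the MODEL O-NE9-1 (species (a) data); `act` ∕ `ker` and NEEDS-COORDINATOR #5 untouched.

WHY THIS FILE.  `Support/NE9CurChartOfBackground.cur_chart_exists_of_W_H126` (gen 78) built the chart of `cur U` at the ONE-STEP letters (the
declared reading (M3) «one averaging level only»); print's `j`-th step works with the `k`-LEVEL operator (3.26) whose averagings are the COMPOSITES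
(3.15)∕(3.19).  Every letter of the one-step chart has since been typed one storey up (`B9Eq326OperatorTower`, `B11Eq44CLetterTower`, and this
generation's `B9Eq326OperatorTowerFlat` ∕ `B9Thm311SmallFieldCoercivityTower` ∕ `B9Eq315QTowerLipschitz` ∕ `B7Eq43AveragedSmallness`).

WHAT THIS FILE PROVES (0 def, 0 sorry, axioms standard).  §1 **`cur_chart_exists_tower_of_W_H126`** — at the `(n+1)`-LEVEL letters
`𝔊 := frakGLatticeCLM φ hpos (QkW_surjective …)`, `H₁ := H1LatticeCLM φ hpos (QkW_surjective …)` (lit-balaban's generic constructions at the tower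
operator `laplaceAk` and «Q_k onto»), `C := Cck L m η (n+1) U …` (leaf-03's `k`-level (44) letter) and the radii of `B11Eq118RegimeRadii.exists_twoRegimes_radii`,
the chart `chartHB 𝔊 0 W 0 (A′ ↦ A′ + solA H₁ 0 C 0 ε_C A′) ε₄ H₁` satisfies (Ψ1) `DifferentiableOn ℂ` on `ball 0 R_b`, (Ψ2) `MapsTo (ball 0 R_b) (ball 0 R′)`,
(Ψ3) value `0` at `0` — given the DISPLAYED positivity `hpos` of `laplaceAk` (E167), the (L3) slot `W` (`QuadAnalytic W C₄ a₃`, analytic), and the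
[Balaban1985Averaging] Prop. 2 letters of `Cck` (`2 ≤ L`, an averaging-closed subgroup `G ∋` the bond variables, `α₀` with `C₀α₀ ≤ 1∕3`, `4α₀ ≤ c₂′`,
the plaquette deviation `pdev(Ũ) < α₀L^{−2(n+1)}`, `n+1 ≤ lev₀`, the radius `ρ` with its two numerical conditions).  §2 **`cur_chart_exists_tower_of_small_field_unitary`**
— the same with `hpos` PRODUCED: for every `CS ≥ 0` there is `ε₀ > 0` such that at every background with `U(b) ∈ U1`, `U(b)` unitary, `‖U(b) − 1‖ ≤ ε`,
right inverses `S₁`∕`S₂` of `Q′_k(1)`∕`Q′_k(U)` bounded by `CS`, tower averaging letters `ρ′`, `δ_Q` with `ε + ρ′ + δ_Q ≤ ε₀` (all DISPLAYED, as in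
`B9Thm311SmallFieldCoercivityTower.laplaceAk_pos_of_small_field_unitary`), `∃ hpos` AND the triple (Ψ1)–(Ψ3) at that `hpos`.
DISGUISE TEST: composition by name of landed theorems one storey up; no inequality of the series proved; per LATTICE and per `k`; the right
inverse of `Q′_k`, [Balaban1985Averaging] Prop. 2's gauge-group letters and the (L3) slot stay DISPLAYED; NOT print's uniformity ([B9] Thms
3.12∕3.13), NOT the gauge step of p. 416, NOT claimed that Bałaban's 𝐇_k ∕ U_j(□₀, exp iB) meet these letters (O-NE9-1; #5 UNRULED); not NE9.
References (TYPES ∕ loci only): [Balaban1985Variational] (44)–(47) p. 285, Prop. 3 p. 289, (172)–(175) p. 305; [Balaban1985BackgroundPropagators]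
(3.15)∕(3.19) p. 393, (3.26) p. 395, Thm 3.11 p. 416; [Balaban1985Averaging] (42)–(43) pp. 23–24, Prop. 2 (52)–(54) p. 26; [Balaban1987RG1] Lemma 4 p. 280.
-/

noncomputable section

open Metric Set

namespace Summit.QuantumFields.BalabanUV.T4Continuum.NE9CurChartTower

open scoped InnerProductSpace
open Literature.MathematicalPhysics.QuantumFieldTheory.Balaban1983to89
open B11Eq103H1Complex B11Eq115Space B11Eq174Chart
open B11Eq111FrakG (nabla115)
open B13Contraction113 (QuadAnalytic)
open B9SectCLatticeCarrier (Bond)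
open B4Sect5Torus (TSite)
open B7Prop1Explicit (U1 Wcx boxVec)
open B7Prop2Explicit (pdev AvgClosed C0 c2')
open B7Prop3Flat (c3)
open B9Eq315QTorus (perCfg cornerSite)
open B9Eq315QTower (towerP UlevOf)
open B9Eq315QTowerFlat (perCfg_UlevOf_one_mem_U1 norm_Wcx_UlevOf_one_sub_one_le)
open B9Eq326OperatorTower (QprimeTowerW QkW QkW_surjective laplaceAk)
open B9Eq310HessianOperator (adTransportW)
open B11Eq118RegimeRadii (exists_twoRegimes_radii)
open B11Eq44COperatorTower (C2T C2T_nonneg αT αT_le ulev_mem_U1_of_pdev ulev_reg_of_pdev)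
open B11Eq44CLetterTower (Cck quadAnalytic_Cck analyticOnNhd_Cck)
open B9Thm311SmallFieldCoercivityTower (laplaceAk_pos_of_small_field_unitary)
open B9Eq315QTowerLipschitz (norm_QprimeTowerW_sub_flat_le norm_QkW_sub_flat_le)
open B7Eq43AveragedSmallness (norm_UlevOf_sub_one_le pdev_le_of_bonds)
open B9Eq315QTorusOnto (liftSite perSite_liftSite)
open Summit.QuantumFields.BalabanUV.T4Continuum.NE9B11ChartAnalytic (chartHB_triple_of_twoRegimes)

/-- **§1 THE CHART OF `cur U` FOR THE `(n+1)`-LEVEL OPERATOR EXISTS AS AN ANALYTIC OBJECT ON A BALL, MODULO THE (L3) LETTER `W`, THE DISPLAYED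
POSITIVITY AND [Balaban1985Averaging] PROP. 2's LETTERS OF `C_k`** — `NE9CurChartOfBackground.cur_chart_exists_of_W_H126` one storey up: `𝔊`, `H₁` =
lit-balaban's `frakGLatticeCLM` ∕ `H1LatticeCLM` at `laplaceAk` and «Q_k onto», `C := Cck …` (NE9 leaf-03), radii from `exists_twoRegimes_radii`. [folklore] -/
theorem cur_chart_exists_tower_of_W_H126 {d : ℕ} (L : ℕ) [NeZero L] (m : Fin d → ℕ) [∀ i, NeZero (m i)] (n : ℕ) (hL : 1 ≤ L) (hL2 : 2 ≤ L)
    {𝔸 : Type*} [NormedRing 𝔸] [NormedAlgebra ℂ 𝔸] [CompleteSpace 𝔸] [NormOneClass 𝔸] [StarRing 𝔸] [StarModule ℂ 𝔸] [FiniteDimensional ℂ 𝔸]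
    {W : Type*} [NormedAddCommGroup W] [InnerProductSpace ℂ W] [FiniteDimensional ℂ W] (φ : W ≃ₗ[ℂ] 𝔸) (τ : 𝔸 →ₗ[ℂ] ℂ)
    {η : ℝ} [Fact (0 < (L : ℝ))] [Fact (0 < η)] {lev₀ : Bond d (towerP L m (n + 1)) → ℕ} {levB : Bond d m → ℕ}
    (lev₁ : Bond d (towerP L m (n + 1)) × Fin d → ℕ)
    (U : Bond d (towerP L m (n + 1)) → 𝔸ˣ) (α : ℕ → ℝ) (hα1 : ∀ j, α j ≤ 1 / 64)
    (hU1 : ∀ (j : ℕ) (x : B7Prop1Explicit.Site d) (κ : Fin d), perCfg (towerP L m (j + 1)) (UlevOf L m (n + 1) U j) x κ ∈ U1 𝔸)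
    (hreg : ∀ (j : ℕ) (y : TSite d (towerP L m j)) (κ : Fin d) (r : Fin d → Fin L),
      ‖((Wcx L (perCfg (towerP L m (j + 1)) (UlevOf L m (n + 1) U j)) (cornerSite L y) κ (boxVec L r) : 𝔸ˣ) : 𝔸) - 1‖ ≤ α j)
    (hαL : ∀ j, 50 * (d + 1) * α j * (L : ℝ) ^ d ≤ 1 / 2)
    {G : Subgroup 𝔸ˣ} (hG : AvgClosed d L G) (hUG : ∀ (x : B7Prop1Explicit.Site d) (κ : Fin d), perCfg (towerP L m (n + 1)) U x κ ∈ G)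
    {α₀ : ℝ} (hα₀ : 0 < α₀) (hα3 : C0 d * α₀ ≤ 1 / 3) (hα4 : 4 * α₀ ≤ c2' d L)
    (h52 : pdev (perCfg (towerP L m (n + 1)) U) < α₀ * (((L : ℝ) ^ (n + 1))⁻¹) ^ 2) (hlev : ∀ b, n + 1 ≤ lev₀ b) {ρ : ℝ} (hρ0 : 0 < ρ)
    (hρ : Real.exp (4 * (800 * ((d : ℝ) + 1) ^ 2 * ((d : ℝ) + 4)) * α₀) * (1 + 8 * (131072 * ((d : ℝ) + 1) ^ 2) * ρ) ≤ 2) (hρc : 2 * ρ ≤ c3 d L)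
    {c₀ c₁ : ℝ} [Fact (0 < c₀)] [Fact (0 < c₁)] (a : ℝ)
    (hpos : ∀ x : BondL2K ℂ d (towerP L m (n + 1)) c₀ W, x ≠ 0 →
      0 < RCLike.re (inner ℂ x (laplaceAk L m n φ η U hL α hα1 hU1 hreg τ (c₀ := c₀) (c₁ := c₁) a x)))
    {Wq : Space115 (L : ℝ) η lev₀ lev₁ (nabla115 η U) → NegSize (L : ℝ) η lev₀ 3 𝔸} {C₄ a₃ : ℝ} (hW : QuadAnalytic Wq C₄ a₃) (hC₄ : 0 ≤ C₄)
    (ha₃ : 0 < a₃) (hWa : AnalyticOnNhd ℂ Wq {Y | ‖Y‖ < a₃}) :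
    ∃ ε₄ εC Rb R' : ℝ, 0 < Rb ∧ 0 < R' ∧
      DifferentiableOn ℂ (chartHB (frakGLatticeCLM (lev₀ := lev₀) φ hpos (QkW_surjective L m n φ U hL α hα1 hU1 hreg hαL) lev₁ (nabla115 η U))
          0 Wq 0 (fun A' => A' + solA (H1LatticeCLM (lev₀ := lev₀) (levB := levB) φ hpos (QkW_surjective L m n φ U hL α hα1 hU1 hreg hαL) lev₁
            (nabla115 η U)) 0 (Cck L m η (n + 1) U lev₀ lev₁ (nabla115 η U) levB) 0 εC A') ε₄
          (H1LatticeCLM (lev₀ := lev₀) (levB := levB) φ hpos (QkW_surjective L m n φ U hL α hα1 hU1 hreg hαL) lev₁ (nabla115 η U)))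
        (ball (0 : NegSize (L : ℝ) η levB 0 𝔸) Rb) ∧
      MapsTo (chartHB (frakGLatticeCLM (lev₀ := lev₀) φ hpos (QkW_surjective L m n φ U hL α hα1 hU1 hreg hαL) lev₁ (nabla115 η U))
          0 Wq 0 (fun A' => A' + solA (H1LatticeCLM (lev₀ := lev₀) (levB := levB) φ hpos (QkW_surjective L m n φ U hL α hα1 hU1 hreg hαL) lev₁
            (nabla115 η U)) 0 (Cck L m η (n + 1) U lev₀ lev₁ (nabla115 η U) levB) 0 εC A') ε₄
          (H1LatticeCLM (lev₀ := lev₀) (levB := levB) φ hpos (QkW_surjective L m n φ U hL α hα1 hU1 hreg hαL) lev₁ (nabla115 η U)))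
        (ball (0 : NegSize (L : ℝ) η levB 0 𝔸) Rb) (ball (0 : Space115 (L : ℝ) η lev₀ lev₁ (nabla115 η U)) R') ∧
      chartHB (frakGLatticeCLM (lev₀ := lev₀) φ hpos (QkW_surjective L m n φ U hL α hα1 hU1 hreg hαL) lev₁ (nabla115 η U))
          0 Wq 0 (fun A' => A' + solA (H1LatticeCLM (lev₀ := lev₀) (levB := levB) φ hpos (QkW_surjective L m n φ U hL α hα1 hU1 hreg hαL) lev₁
            (nabla115 η U)) 0 (Cck L m η (n + 1) U lev₀ lev₁ (nabla115 η U) levB) 0 εC A') ε₄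
          (H1LatticeCLM (lev₀ := lev₀) (levB := levB) φ hpos (QkW_surjective L m n φ U hL α hα1 hU1 hreg hαL) lev₁ (nabla115 η U)) 0 = 0 := by
  have hC := quadAnalytic_Cck L m η (n + 1) U lev₀ lev₁ (nabla115 η U) levB hL2 hG hUG hα₀ hα3 hα4 h52 hlev hρ hρc
  have hCa := analyticOnNhd_Cck L m η (n + 1) U lev₀ lev₁ (nabla115 η U) levB hL2 hG hUG hα₀ hα3 hα4 h52 hlev hρ hρc
  obtain ⟨j, a', ε₄, aC, εC, R', Rb, hj, ha', -, -, -, hR'0, hRb0, R, RC, hcap, hRb, hR'⟩ :=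
    exists_twoRegimes_radii (frakGLatticeCLM (lev₀ := lev₀) φ hpos (QkW_surjective L m n φ U hL α hα1 hU1 hreg hαL) lev₁ (nabla115 η U))
      hW hC₄ ha₃ (H1LatticeCLM (lev₀ := lev₀) (levB := levB) φ hpos (QkW_surjective L m n φ U hL α hα1 hU1 hreg hαL) lev₁ (nabla115 η U))
      hC (C2T_nonneg d α₀) hρ0
      (H1LatticeCLM (lev₀ := lev₀) (levB := levB) φ hpos (QkW_surjective L m n φ U hL α hα1 hU1 hreg hαL) lev₁ (nabla115 η U))
  exact ⟨ε₄, εC, Rb, R', hRb0, hR'0, chartHB_triple_of_twoRegimes R hWa hj.le ha' RC hCa hcap _ hRb hR'0 hR'⟩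

/-- **§2 THE SAME WITH THE POSITIVITY PRODUCED** by this generation's `laplaceAk_pos_of_small_field_unitary` (modulo the displayed tower averaging
letters `ρ′`, `δ_Q` and right inverses `S₁`∕`S₂` of `Q′_k(1)`∕`Q′_k(U)` bounded by `CS`): `∀ CS ≥ 0, ∃ ε₀ > 0, ∀ U …, ∃ hpos` AND §1's triple at that `hpos`,
at every unitary small-bond background of a fixed lattice with the per-level tower data displayed. [folklore] -/
theorem cur_chart_exists_tower_of_small_field_unitary {d : ℕ} (L : ℕ) [NeZero L] (m : Fin d → ℕ) [∀ i, NeZero (m i)] (n : ℕ) (hL : 1 ≤ L)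
    (hL2 : 2 ≤ L)
    {𝔸 : Type*} [NormedRing 𝔸] [NormedAlgebra ℂ 𝔸] [CompleteSpace 𝔸] [NormOneClass 𝔸] [StarRing 𝔸] [NormedStarGroup 𝔸] [StarModule ℂ 𝔸]
    [FiniteDimensional ℂ 𝔸]
    {W : Type*} [NormedAddCommGroup W] [InnerProductSpace ℂ W] [FiniteDimensional ℂ W] (φ : W ≃ₗ[ℂ] 𝔸) {Mφ Mφ' : ℝ} (hMφ : 0 ≤ Mφ)
    (hMφ' : 0 ≤ Mφ') (hφ : ∀ w, ‖φ w‖ ≤ Mφ * ‖w‖) (hφ' : ∀ X, ‖φ.symm X‖ ≤ Mφ' * ‖X‖)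
    (τ : 𝔸 →ₗ[ℂ] ℂ) {Cτ : ℝ} (hτ : ∀ X, ‖τ X‖ ≤ Cτ * ‖X‖) (hCτ : 0 ≤ Cτ)
    (hτφ : ∀ X Y : 𝔸, inner ℂ (φ.symm X) (φ.symm Y) = τ (star X * Y)) (htr : ∀ X Y : 𝔸, τ (X * Y) = τ (Y * X))
    {η : ℝ} (hη : η ≠ 0) [Fact (0 < (L : ℝ))] [Fact (0 < η)] {lev₀ : Bond d (towerP L m (n + 1)) → ℕ} {levB : Bond d m → ℕ}
    (lev₁ : Bond d (towerP L m (n + 1)) × Fin d → ℕ) (α : ℕ → ℝ) (hα1 : ∀ j, α j ≤ 1 / 64) (hαL : ∀ j, 50 * (d + 1) * α j * (L : ℝ) ^ d ≤ 1 / 2)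
    {G : Subgroup 𝔸ˣ} (hG : AvgClosed d L G) {α₀ : ℝ} (hα₀ : 0 < α₀) (hα3 : C0 d * α₀ ≤ 1 / 3) (hα4 : 4 * α₀ ≤ c2' d L) (hlev : ∀ b, n + 1 ≤ lev₀ b)
    {ρ : ℝ} (hρ0 : 0 < ρ) (hρ : Real.exp (4 * (800 * ((d : ℝ) + 1) ^ 2 * ((d : ℝ) + 4)) * α₀) * (1 + 8 * (131072 * ((d : ℝ) + 1) ^ 2) * ρ) ≤ 2)
    (hρc : 2 * ρ ≤ c3 d L) {c₀ c₁ : ℝ} [Fact (0 < c₀)] [Fact (0 < c₁)] {a : ℝ} (ha : 0 < a) {CS : ℝ} (hCS : 0 ≤ CS) :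
    ∃ ε₀ : ℝ, 0 < ε₀ ∧ ∀ (U : Bond d (towerP L m (n + 1)) → 𝔸ˣ)
      (hU1 : ∀ (j : ℕ) (x : B7Prop1Explicit.Site d) (κ : Fin d), perCfg (towerP L m (j + 1)) (UlevOf L m (n + 1) U j) x κ ∈ U1 𝔸)
      (hreg : ∀ (j : ℕ) (y : TSite d (towerP L m j)) (κ : Fin d) (r : Fin d → Fin L),
        ‖((Wcx L (perCfg (towerP L m (j + 1)) (UlevOf L m (n + 1) U j)) (cornerSite L y) κ (boxVec L r) : 𝔸ˣ) : 𝔸) - 1‖ ≤ α j)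
      (S₁ S₂ : (TSite d m → W) →ₗ[ℂ] SiteL2K ℂ d (towerP L m (n + 1)) c₀ W)
      {ε ρ' δQ : ℝ}, 0 ≤ ε → 0 ≤ ρ' → 0 ≤ δQ → ε + ρ' + δQ ≤ ε₀ →
      (∀ b, U b ∈ U1 𝔸) → (∀ b, ‖(U b : 𝔸) - 1‖ ≤ ε) → (∀ b, star (U b : 𝔸) = (((U b)⁻¹ : 𝔸ˣ) : 𝔸)) →
      (∀ f, QprimeTowerW L m n φ (fun _ : Bond d (towerP L m (n + 1)) => (1 : 𝔸ˣ)) (S₁ f) = f) →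
      (∀ f, QprimeTowerW L m n φ U (S₂ f) = f) → (∀ f, ‖S₁ f‖ ≤ CS * ‖f‖) → (∀ f, ‖S₂ f‖ ≤ CS * ‖f‖) →
      (∀ l : SiteL2K ℂ d (towerP L m (n + 1)) c₀ W,
        ‖QprimeTowerW L m n φ U l - QprimeTowerW L m n φ (fun _ : Bond d (towerP L m (n + 1)) => (1 : 𝔸ˣ)) l‖ ≤ ρ' * ‖l‖) →
      (∀ x : BondL2K ℂ d (towerP L m (n + 1)) c₀ W, ‖QkW L m n φ U hL α hα1 hU1 hreg (c₁ := c₁) x -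
        QkW L m n φ (fun _ : Bond d (towerP L m (n + 1)) => (1 : 𝔸ˣ)) hL (fun _ => 0) (fun _ => by norm_num)
          (perCfg_UlevOf_one_mem_U1 L m (n + 1)) (norm_Wcx_UlevOf_one_sub_one_le L m (n + 1) (fun _ => 0) (fun _ => le_rfl)) (c₁ := c₁) x‖ ≤
        δQ * ‖x‖) →
      (∀ (x : B7Prop1Explicit.Site d) (κ : Fin d), perCfg (towerP L m (n + 1)) U x κ ∈ G) →
      pdev (perCfg (towerP L m (n + 1)) U) < α₀ * (((L : ℝ) ^ (n + 1))⁻¹) ^ 2 →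
      ∀ {Wq : Space115 (L : ℝ) η lev₀ lev₁ (nabla115 η U) → NegSize (L : ℝ) η lev₀ 3 𝔸} {C₄ a₃ : ℝ}, QuadAnalytic Wq C₄ a₃ → 0 ≤ C₄ → 0 < a₃ →
        AnalyticOnNhd ℂ Wq {Y | ‖Y‖ < a₃} →
      ∃ hpos : ∀ x : BondL2K ℂ d (towerP L m (n + 1)) c₀ W, x ≠ 0 →
          0 < RCLike.re (inner ℂ x (laplaceAk L m n φ η U hL α hα1 hU1 hreg τ (c₀ := c₀) (c₁ := c₁) a x)),
      ∃ ε₄ εC Rb R' : ℝ, 0 < Rb ∧ 0 < R' ∧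
        DifferentiableOn ℂ (chartHB (frakGLatticeCLM (lev₀ := lev₀) φ hpos (QkW_surjective L m n φ U hL α hα1 hU1 hreg hαL) lev₁ (nabla115 η U))
            0 Wq 0 (fun A' => A' + solA (H1LatticeCLM (lev₀ := lev₀) (levB := levB) φ hpos (QkW_surjective L m n φ U hL α hα1 hU1 hreg hαL) lev₁
              (nabla115 η U)) 0 (Cck L m η (n + 1) U lev₀ lev₁ (nabla115 η U) levB) 0 εC A') ε₄
            (H1LatticeCLM (lev₀ := lev₀) (levB := levB) φ hpos (QkW_surjective L m n φ U hL α hα1 hU1 hreg hαL) lev₁ (nabla115 η U)))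
          (ball (0 : NegSize (L : ℝ) η levB 0 𝔸) Rb) ∧
        MapsTo (chartHB (frakGLatticeCLM (lev₀ := lev₀) φ hpos (QkW_surjective L m n φ U hL α hα1 hU1 hreg hαL) lev₁ (nabla115 η U))
            0 Wq 0 (fun A' => A' + solA (H1LatticeCLM (lev₀ := lev₀) (levB := levB) φ hpos (QkW_surjective L m n φ U hL α hα1 hU1 hreg hαL) lev₁
              (nabla115 η U)) 0 (Cck L m η (n + 1) U lev₀ lev₁ (nabla115 η U) levB) 0 εC A') ε₄
            (H1LatticeCLM (lev₀ := lev₀) (levB := levB) φ hpos (QkW_surjective L m n φ U hL α hα1 hU1 hreg hαL) lev₁ (nabla115 η U)))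
          (ball (0 : NegSize (L : ℝ) η levB 0 𝔸) Rb) (ball (0 : Space115 (L : ℝ) η lev₀ lev₁ (nabla115 η U)) R') ∧
        chartHB (frakGLatticeCLM (lev₀ := lev₀) φ hpos (QkW_surjective L m n φ U hL α hα1 hU1 hreg hαL) lev₁ (nabla115 η U))
            0 Wq 0 (fun A' => A' + solA (H1LatticeCLM (lev₀ := lev₀) (levB := levB) φ hpos (QkW_surjective L m n φ U hL α hα1 hU1 hreg hαL) lev₁
              (nabla115 η U)) 0 (Cck L m η (n + 1) U lev₀ lev₁ (nabla115 η U) levB) 0 εC A') ε₄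
            (H1LatticeCLM (lev₀ := lev₀) (levB := levB) φ hpos (QkW_surjective L m n φ U hL α hα1 hU1 hreg hαL) lev₁ (nabla115 η U)) 0 = 0 := by
  obtain ⟨ε₀, hε₀, H⟩ := laplaceAk_pos_of_small_field_unitary L m n hL φ (c₀ := c₀) (c₁ := c₁) α hα1 hη ha hMφ hMφ' hφ hφ' τ hτ hCτ hτφ htr hCS
  refine ⟨ε₀, hε₀, ?_⟩
  intro U hU1 hreg S₁ S₂ ε ρ' δQ hε hρ' hδQ ht hUb hUε hUstar hS₁ hS₂ hS₁n hS₂n hQ' hQ hUG h52 Wq C₄ a₃ hW hC₄ ha₃ hWa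
  have hpos := H U hU1 hreg S₁ S₂ hε hρ' hδQ ht hUb hUε hUstar hS₁ hS₂ hS₁n hS₂n hQ' hQ
  exact ⟨hpos, cur_chart_exists_tower_of_W_H126 L m n hL hL2 φ τ lev₁ U α hα1 hU1 hreg hαL hG hUG hα₀ hα3 hα4 h52 hlev hρ0 hρ hρc a hpos
    hW hC₄ ha₃ hWa⟩

/-- **§3 THE SAME AT [Balaban1985Averaging] PROP. 2's DATA — the per-level displays `hU1`, `hreg`, `hαL` PRODUCED** (NE9 leaf-03's
`ulev_mem_U1_of_pdev` ∕ `ulev_reg_of_pdev`: every `Ū^j` is `G`-valued and `αT`-regular once `Ũ ∈ G` (averaging-closed) and `pdev(Ũ) < α₀L^{−2(n+1)}`;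
profile `α_j := αT d L α₀`, regime `50(d+1)·αT·L^d ≤ 1∕2`); `ρ′`, `δ_Q` and the right inverses still displayed. [folklore] -/
theorem cur_chart_exists_tower_of_pdev_unitary {d : ℕ} (L : ℕ) [NeZero L] (m : Fin d → ℕ) [∀ i, NeZero (m i)] (n : ℕ) (hL : 1 ≤ L)
    (hL2 : 2 ≤ L)
    {𝔸 : Type*} [NormedRing 𝔸] [NormedAlgebra ℂ 𝔸] [CompleteSpace 𝔸] [NormOneClass 𝔸] [StarRing 𝔸] [NormedStarGroup 𝔸] [StarModule ℂ 𝔸]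
    [FiniteDimensional ℂ 𝔸]
    {W : Type*} [NormedAddCommGroup W] [InnerProductSpace ℂ W] [FiniteDimensional ℂ W] (φ : W ≃ₗ[ℂ] 𝔸) {Mφ Mφ' : ℝ} (hMφ : 0 ≤ Mφ)
    (hMφ' : 0 ≤ Mφ') (hφ : ∀ w, ‖φ w‖ ≤ Mφ * ‖w‖) (hφ' : ∀ X, ‖φ.symm X‖ ≤ Mφ' * ‖X‖)
    (τ : 𝔸 →ₗ[ℂ] ℂ) {Cτ : ℝ} (hτ : ∀ X, ‖τ X‖ ≤ Cτ * ‖X‖) (hCτ : 0 ≤ Cτ)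
    (hτφ : ∀ X Y : 𝔸, inner ℂ (φ.symm X) (φ.symm Y) = τ (star X * Y)) (htr : ∀ X Y : 𝔸, τ (X * Y) = τ (Y * X))
    {η : ℝ} (hη : η ≠ 0) [Fact (0 < (L : ℝ))] [Fact (0 < η)] {lev₀ : Bond d (towerP L m (n + 1)) → ℕ} {levB : Bond d m → ℕ}
    (lev₁ : Bond d (towerP L m (n + 1)) × Fin d → ℕ)
    {G : Subgroup 𝔸ˣ} (hG : AvgClosed d L G) {α₀ : ℝ} (hα₀ : 0 < α₀) (hα3 : C0 d * α₀ ≤ 1 / 3) (hα4 : 4 * α₀ ≤ c2' d L)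
    (hαL : 50 * (d + 1) * αT d L α₀ * (L : ℝ) ^ d ≤ 1 / 2) (hlev : ∀ b, n + 1 ≤ lev₀ b)
    {ρ : ℝ} (hρ0 : 0 < ρ) (hρ : Real.exp (4 * (800 * ((d : ℝ) + 1) ^ 2 * ((d : ℝ) + 4)) * α₀) * (1 + 8 * (131072 * ((d : ℝ) + 1) ^ 2) * ρ) ≤ 2)
    (hρc : 2 * ρ ≤ c3 d L) {c₀ c₁ : ℝ} [Fact (0 < c₀)] [Fact (0 < c₁)] {a : ℝ} (ha : 0 < a) {CS : ℝ} (hCS : 0 ≤ CS) :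
    ∃ ε₀ : ℝ, 0 < ε₀ ∧ ∀ (U : Bond d (towerP L m (n + 1)) → 𝔸ˣ)
      (hUG : ∀ (x : B7Prop1Explicit.Site d) (κ : Fin d), perCfg (towerP L m (n + 1)) U x κ ∈ G)
      (h52 : pdev (perCfg (towerP L m (n + 1)) U) < α₀ * (((L : ℝ) ^ (n + 1))⁻¹) ^ 2)
      (S₁ S₂ : (TSite d m → W) →ₗ[ℂ] SiteL2K ℂ d (towerP L m (n + 1)) c₀ W)
      {ε ρ' δQ : ℝ}, 0 ≤ ε → 0 ≤ ρ' → 0 ≤ δQ → ε + ρ' + δQ ≤ ε₀ →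
      (∀ b, U b ∈ U1 𝔸) → (∀ b, ‖(U b : 𝔸) - 1‖ ≤ ε) → (∀ b, star (U b : 𝔸) = (((U b)⁻¹ : 𝔸ˣ) : 𝔸)) →
      (∀ f, QprimeTowerW L m n φ (fun _ : Bond d (towerP L m (n + 1)) => (1 : 𝔸ˣ)) (S₁ f) = f) →
      (∀ f, QprimeTowerW L m n φ U (S₂ f) = f) → (∀ f, ‖S₁ f‖ ≤ CS * ‖f‖) → (∀ f, ‖S₂ f‖ ≤ CS * ‖f‖) →
      (∀ l : SiteL2K ℂ d (towerP L m (n + 1)) c₀ W,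
        ‖QprimeTowerW L m n φ U l - QprimeTowerW L m n φ (fun _ : Bond d (towerP L m (n + 1)) => (1 : 𝔸ˣ)) l‖ ≤ ρ' * ‖l‖) →
      (∀ x : BondL2K ℂ d (towerP L m (n + 1)) c₀ W,
        ‖QkW L m n φ U hL (fun _ => αT d L α₀) (fun _ => αT_le hL hα4) (ulev_mem_U1_of_pdev L m (n + 1) U hL2 hG hUG hα₀ hα3 hα4 h52)
            (ulev_reg_of_pdev L m (n + 1) U hL2 hG hUG hα₀ hα3 hα4 h52) (c₁ := c₁) x -
          QkW L m n φ (fun _ : Bond d (towerP L m (n + 1)) => (1 : 𝔸ˣ)) hL (fun _ => 0) (fun _ => by norm_num)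
            (perCfg_UlevOf_one_mem_U1 L m (n + 1)) (norm_Wcx_UlevOf_one_sub_one_le L m (n + 1) (fun _ => 0) (fun _ => le_rfl)) (c₁ := c₁) x‖ ≤
        δQ * ‖x‖) →
      ∀ {Wq : Space115 (L : ℝ) η lev₀ lev₁ (nabla115 η U) → NegSize (L : ℝ) η lev₀ 3 𝔸} {C₄ a₃ : ℝ}, QuadAnalytic Wq C₄ a₃ → 0 ≤ C₄ → 0 < a₃ →
        AnalyticOnNhd ℂ Wq {Y | ‖Y‖ < a₃} →
      ∃ hpos : ∀ x : BondL2K ℂ d (towerP L m (n + 1)) c₀ W, x ≠ 0 →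
          0 < RCLike.re (inner ℂ x (laplaceAk L m n φ η U hL (fun _ => αT d L α₀) (fun _ => αT_le hL hα4)
            (ulev_mem_U1_of_pdev L m (n + 1) U hL2 hG hUG hα₀ hα3 hα4 h52) (ulev_reg_of_pdev L m (n + 1) U hL2 hG hUG hα₀ hα3 hα4 h52) τ
            (c₀ := c₀) (c₁ := c₁) a x)),
      ∃ ε₄ εC Rb R' : ℝ, 0 < Rb ∧ 0 < R' ∧
        DifferentiableOn ℂ (chartHB (frakGLatticeCLM (lev₀ := lev₀) φ hpos (QkW_surjective L m n φ U hL _ _ _ _ fun _ => hαL) lev₁ (nabla115 η U))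
            0 Wq 0 (fun A' => A' + solA (H1LatticeCLM (lev₀ := lev₀) (levB := levB) φ hpos (QkW_surjective L m n φ U hL _ _ _ _ fun _ => hαL) lev₁
              (nabla115 η U)) 0 (Cck L m η (n + 1) U lev₀ lev₁ (nabla115 η U) levB) 0 εC A') ε₄
            (H1LatticeCLM (lev₀ := lev₀) (levB := levB) φ hpos (QkW_surjective L m n φ U hL _ _ _ _ fun _ => hαL) lev₁ (nabla115 η U)))
          (ball (0 : NegSize (L : ℝ) η levB 0 𝔸) Rb) ∧
        MapsTo (chartHB (frakGLatticeCLM (lev₀ := lev₀) φ hpos (QkW_surjective L m n φ U hL _ _ _ _ fun _ => hαL) lev₁ (nabla115 η U))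
            0 Wq 0 (fun A' => A' + solA (H1LatticeCLM (lev₀ := lev₀) (levB := levB) φ hpos (QkW_surjective L m n φ U hL _ _ _ _ fun _ => hαL) lev₁
              (nabla115 η U)) 0 (Cck L m η (n + 1) U lev₀ lev₁ (nabla115 η U) levB) 0 εC A') ε₄
            (H1LatticeCLM (lev₀ := lev₀) (levB := levB) φ hpos (QkW_surjective L m n φ U hL _ _ _ _ fun _ => hαL) lev₁ (nabla115 η U)))
          (ball (0 : NegSize (L : ℝ) η levB 0 𝔸) Rb) (ball (0 : Space115 (L : ℝ) η lev₀ lev₁ (nabla115 η U)) R') ∧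
        chartHB (frakGLatticeCLM (lev₀ := lev₀) φ hpos (QkW_surjective L m n φ U hL _ _ _ _ fun _ => hαL) lev₁ (nabla115 η U))
            0 Wq 0 (fun A' => A' + solA (H1LatticeCLM (lev₀ := lev₀) (levB := levB) φ hpos (QkW_surjective L m n φ U hL _ _ _ _ fun _ => hαL) lev₁
              (nabla115 η U)) 0 (Cck L m η (n + 1) U lev₀ lev₁ (nabla115 η U) levB) 0 εC A') ε₄
            (H1LatticeCLM (lev₀ := lev₀) (levB := levB) φ hpos (QkW_surjective L m n φ U hL _ _ _ _ fun _ => hαL) lev₁ (nabla115 η U)) 0 = 0 := by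
  obtain ⟨ε₀, hε₀, H⟩ := cur_chart_exists_tower_of_small_field_unitary L m n hL hL2 φ (c₀ := c₀) (c₁ := c₁) (lev₀ := lev₀) (levB := levB) hMφ hMφ'
    hφ hφ' τ hτ hCτ hτφ htr hη lev₁ (fun _ => αT d L α₀) (fun _ => αT_le hL hα4) (fun _ => hαL) hG hα₀ hα3 hα4 hlev hρ0 hρ hρc ha hCS
  refine ⟨ε₀, hε₀, ?_⟩
  intro U hUG h52 S₁ S₂ ε ρ' δQ hε hρ' hδQ ht hUb hUε hUstar hS₁ hS₂ hS₁n hS₂n hQ' hQ Wq C₄ a₃ hW hC₄ ha₃ hWa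
  exact H U (ulev_mem_U1_of_pdev L m (n + 1) U hL2 hG hUG hα₀ hα3 hα4 h52) (ulev_reg_of_pdev L m (n + 1) U hL2 hG hUG hα₀ hα3 hα4 h52) S₁ S₂
    hε hρ' hδQ ht hUb hUε hUstar hS₁ hS₂ hS₁n hS₂n hQ' hQ hUG h52 hW hC₄ ha₃ hWa


/-- The linear majorant `(1 + ε)^n − 1 ≤ n·ε·(1 + ε)^n` for `ε ≥ 0` (private arithmetic helper, as in `B9Eq319QprimeLipschitz`). [folklore] -/
private theorem pow_sub_one_le_mul' {ε : ℝ} (hε : 0 ≤ ε) : ∀ n : ℕ, (1 + ε) ^ n - 1 ≤ n * ε * (1 + ε) ^ n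
  | 0 => by simp
  | n + 1 => by
    have ih := pow_sub_one_le_mul' hε n
    have h1 : (1 : ℝ) ≤ (1 + ε) ^ n := one_le_pow₀ (by linarith)
    rw [pow_succ, Nat.cast_succ]
    have h3 : 0 ≤ ((n : ℝ) + 1) * ε * (1 + ε) ^ n := by positivity
    calc (1 + ε) ^ n * (1 + ε) - 1 = ((1 + ε) ^ n - 1) + ε * (1 + ε) ^ n := by ring
      _ ≤ (n : ℝ) * ε * (1 + ε) ^ n + ε * (1 + ε) ^ n := by gcongr
      _ = ((n : ℝ) + 1) * ε * (1 + ε) ^ n := by ring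
      _ ≤ ((n : ℝ) + 1) * ε * (1 + ε) ^ n * (1 + ε) := le_mul_of_one_le_right h3 (by linarith)
      _ = ((n : ℝ) + 1) * ε * ((1 + ε) ^ n * (1 + ε)) := by ring

/-- **§4 THE `ε`-ONLY FORM — THE CHART OF `cur U` FOR PRINT's `k`-TH-STEP OPERATOR AT EVERY UNITARY SMALL-BOND BACKGROUND, the tower averaging
letters PRODUCED** (`B9Eq315QTowerLipschitz.norm_QprimeTowerW_sub_flat_le` ∕ `norm_QkW_sub_flat_le` by telescoping, the level averages' smallness
`(8(d+1)L)^{n+1}·ε` by `B7Eq43AveragedSmallness.norm_UlevOf_sub_one_le`, their unit-boundedness by `ulev_mem_U1_of_pdev`): for every `CS ≥ 0` there is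
`ε₁ > 0` (a finite-lattice number) such that for EVERY `U` with `U(b) ∈ U1`, `U(b)* = U(b)⁻¹`, **`‖U(b) − 1‖ ≤ ε ≤ ε₁`**, `Ũ ∈ G`, and right
inverses `S₁`∕`S₂` of `Q′_k(1)`∕`Q′_k(U)` bounded by `CS`: `∃ h52` ((52) `pdev(Ũ) < α₀L^{−2(n+1)}` from `pdev ≤ 4ε`, `pdev_le_of_bonds`), `∃ hpos` and the
triple (Ψ1)–(Ψ3) of §1.  Displayed background letters left: `ε`, the gauge group `G` (averaging-closed) with `Cck`'s numerics `α₀`∕`ρ`, the sections. [folklore] -/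
theorem cur_chart_exists_tower_of_small_bonds_unitary {d : ℕ} (L : ℕ) [NeZero L] (m : Fin d → ℕ) [∀ i, NeZero (m i)] (n : ℕ) (hL : 1 ≤ L)
    (hL2 : 2 ≤ L)
    {𝔸 : Type*} [NormedRing 𝔸] [NormedAlgebra ℂ 𝔸] [CompleteSpace 𝔸] [NormOneClass 𝔸] [StarRing 𝔸] [NormedStarGroup 𝔸] [StarModule ℂ 𝔸]
    [FiniteDimensional ℂ 𝔸]
    {W : Type*} [NormedAddCommGroup W] [InnerProductSpace ℂ W] [FiniteDimensional ℂ W] (φ : W ≃ₗ[ℂ] 𝔸) {Mφ Mφ' : ℝ} (hMφ : 0 ≤ Mφ)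
    (hMφ' : 0 ≤ Mφ') (hφ : ∀ w, ‖φ w‖ ≤ Mφ * ‖w‖) (hφ' : ∀ X, ‖φ.symm X‖ ≤ Mφ' * ‖X‖)
    (τ : 𝔸 →ₗ[ℂ] ℂ) {Cτ : ℝ} (hτ : ∀ X, ‖τ X‖ ≤ Cτ * ‖X‖) (hCτ : 0 ≤ Cτ)
    (hτφ : ∀ X Y : 𝔸, inner ℂ (φ.symm X) (φ.symm Y) = τ (star X * Y)) (htr : ∀ X Y : 𝔸, τ (X * Y) = τ (Y * X))
    {η : ℝ} (hη : η ≠ 0) [Fact (0 < (L : ℝ))] [Fact (0 < η)] {lev₀ : Bond d (towerP L m (n + 1)) → ℕ} {levB : Bond d m → ℕ}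
    (lev₁ : Bond d (towerP L m (n + 1)) × Fin d → ℕ)
    {G : Subgroup 𝔸ˣ} (hG : AvgClosed d L G) {α₀ : ℝ} (hα₀ : 0 < α₀) (hα3 : C0 d * α₀ ≤ 1 / 3) (hα4 : 4 * α₀ ≤ c2' d L)
    (hαL : 50 * (d + 1) * αT d L α₀ * (L : ℝ) ^ d ≤ 1 / 2) (hlev : ∀ b, n + 1 ≤ lev₀ b)
    {ρ : ℝ} (hρ0 : 0 < ρ) (hρ : Real.exp (4 * (800 * ((d : ℝ) + 1) ^ 2 * ((d : ℝ) + 4)) * α₀) * (1 + 8 * (131072 * ((d : ℝ) + 1) ^ 2) * ρ) ≤ 2)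
    (hρc : 2 * ρ ≤ c3 d L) {c₀ c₁ : ℝ} [Fact (0 < c₀)] [Fact (0 < c₁)] {a : ℝ} (ha : 0 < a) {CS : ℝ} (hCS : 0 ≤ CS) :
    ∃ ε₁ : ℝ, 0 < ε₁ ∧ ∀ (U : Bond d (towerP L m (n + 1)) → 𝔸ˣ)
      (hUG : ∀ (x : B7Prop1Explicit.Site d) (κ : Fin d), perCfg (towerP L m (n + 1)) U x κ ∈ G)
      (S₁ S₂ : (TSite d m → W) →ₗ[ℂ] SiteL2K ℂ d (towerP L m (n + 1)) c₀ W)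
      {ε : ℝ}, 0 ≤ ε → ε ≤ ε₁ →
      (∀ b, U b ∈ U1 𝔸) → (∀ b, ‖(U b : 𝔸) - 1‖ ≤ ε) → (∀ b, star (U b : 𝔸) = (((U b)⁻¹ : 𝔸ˣ) : 𝔸)) →
      (∀ f, QprimeTowerW L m n φ (fun _ : Bond d (towerP L m (n + 1)) => (1 : 𝔸ˣ)) (S₁ f) = f) →
      (∀ f, QprimeTowerW L m n φ U (S₂ f) = f) → (∀ f, ‖S₁ f‖ ≤ CS * ‖f‖) → (∀ f, ‖S₂ f‖ ≤ CS * ‖f‖) →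
      ∀ {Wq : Space115 (L : ℝ) η lev₀ lev₁ (nabla115 η U) → NegSize (L : ℝ) η lev₀ 3 𝔸} {C₄ a₃ : ℝ}, QuadAnalytic Wq C₄ a₃ → 0 ≤ C₄ → 0 < a₃ →
        AnalyticOnNhd ℂ Wq {Y | ‖Y‖ < a₃} →
      ∃ h52 : pdev (perCfg (towerP L m (n + 1)) U) < α₀ * (((L : ℝ) ^ (n + 1))⁻¹) ^ 2,
      ∃ hpos : ∀ x : BondL2K ℂ d (towerP L m (n + 1)) c₀ W, x ≠ 0 →
          0 < RCLike.re (inner ℂ x (laplaceAk L m n φ η U hL (fun _ => αT d L α₀) (fun _ => αT_le hL hα4)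
            (ulev_mem_U1_of_pdev L m (n + 1) U hL2 hG hUG hα₀ hα3 hα4 h52) (ulev_reg_of_pdev L m (n + 1) U hL2 hG hUG hα₀ hα3 hα4 h52) τ
            (c₀ := c₀) (c₁ := c₁) a x)),
      ∃ ε₄ εC Rb R' : ℝ, 0 < Rb ∧ 0 < R' ∧
        DifferentiableOn ℂ (chartHB (frakGLatticeCLM (lev₀ := lev₀) φ hpos (QkW_surjective L m n φ U hL _ _ _ _ fun _ => hαL) lev₁ (nabla115 η U))
            0 Wq 0 (fun A' => A' + solA (H1LatticeCLM (lev₀ := lev₀) (levB := levB) φ hpos (QkW_surjective L m n φ U hL _ _ _ _ fun _ => hαL) lev₁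
              (nabla115 η U)) 0 (Cck L m η (n + 1) U lev₀ lev₁ (nabla115 η U) levB) 0 εC A') ε₄
            (H1LatticeCLM (lev₀ := lev₀) (levB := levB) φ hpos (QkW_surjective L m n φ U hL _ _ _ _ fun _ => hαL) lev₁ (nabla115 η U)))
          (ball (0 : NegSize (L : ℝ) η levB 0 𝔸) Rb) ∧
        MapsTo (chartHB (frakGLatticeCLM (lev₀ := lev₀) φ hpos (QkW_surjective L m n φ U hL _ _ _ _ fun _ => hαL) lev₁ (nabla115 η U))
            0 Wq 0 (fun A' => A' + solA (H1LatticeCLM (lev₀ := lev₀) (levB := levB) φ hpos (QkW_surjective L m n φ U hL _ _ _ _ fun _ => hαL) lev₁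
              (nabla115 η U)) 0 (Cck L m η (n + 1) U lev₀ lev₁ (nabla115 η U) levB) 0 εC A') ε₄
            (H1LatticeCLM (lev₀ := lev₀) (levB := levB) φ hpos (QkW_surjective L m n φ U hL _ _ _ _ fun _ => hαL) lev₁ (nabla115 η U)))
          (ball (0 : NegSize (L : ℝ) η levB 0 𝔸) Rb) (ball (0 : Space115 (L : ℝ) η lev₀ lev₁ (nabla115 η U)) R') ∧
        chartHB (frakGLatticeCLM (lev₀ := lev₀) φ hpos (QkW_surjective L m n φ U hL _ _ _ _ fun _ => hαL) lev₁ (nabla115 η U))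
            0 Wq 0 (fun A' => A' + solA (H1LatticeCLM (lev₀ := lev₀) (levB := levB) φ hpos (QkW_surjective L m n φ U hL _ _ _ _ fun _ => hαL) lev₁
              (nabla115 η U)) 0 (Cck L m η (n + 1) U lev₀ lev₁ (nabla115 η U) levB) 0 εC A') ε₄
            (H1LatticeCLM (lev₀ := lev₀) (levB := levB) φ hpos (QkW_surjective L m n φ U hL _ _ _ _ fun _ => hαL) lev₁ (nabla115 η U)) 0 = 0 := by
  have hc₀ : 0 < c₀ := Fact.out
  have hL1 : (1 : ℝ) ≤ L := by exact_mod_cast hL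
  have hd : (0 : ℝ) ≤ d := Nat.cast_nonneg d
  obtain ⟨ε₀, hε₀, H⟩ := cur_chart_exists_tower_of_pdev_unitary L m n hL hL2 φ (c₀ := c₀) (c₁ := c₁) (lev₀ := lev₀) (levB := levB) hMφ hMφ' hφ hφ' τ
    hτ hCτ hτφ htr hη lev₁ hG hα₀ hα3 hα4 hαL hlev hρ0 hρ hρc ha hCS
  -- the constants of the produced letters: `ε̄ = Cᵏε`, `ρ′ ≤ Kρ·ε` (for `2M_φM_φ′ε̄ ≤ 1`), `δ_Q = KQ·ε`
  obtain ⟨Ck, hCkdef⟩ : ∃ Ck : ℝ, Ck = (8 * ((d : ℝ) + 1) * L) ^ (n + 1) := ⟨_, rfl⟩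
  have hCk1 : 1 ≤ Ck := by rw [hCkdef]; exact one_le_pow₀ (by nlinarith)
  have hCk0 : 0 < Ck := lt_of_lt_of_le one_pos hCk1
  obtain ⟨Kρ, hKρdef⟩ : ∃ Kρ : ℝ, Kρ = ((d * (L - 1) * (n + 1) : ℕ) : ℝ) * (2 * Mφ * Mφ' * Ck) * 2 ^ (d * (L - 1) * (n + 1)) * (Real.sqrt c₀)⁻¹ :=
    ⟨_, rfl⟩
  have hKρ : 0 ≤ Kρ := by rw [hKρdef]; positivity
  obtain ⟨KQ, hKQdef⟩ : ∃ KQ : ℝ, KQ = Mφ' * Mφ * Real.sqrt (c₁ * Fintype.card (Bond d m) / c₀) * ((2 ^ (n + 1) - 1) * (102 * (d + 1) ^ 2 * L * Ck)) :=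
    ⟨_, rfl⟩
  have h2n : (0 : ℝ) ≤ 2 ^ (n + 1) - 1 := sub_nonneg.2 (one_le_pow₀ (by norm_num))
  have hKQ : 0 ≤ KQ := by rw [hKQdef]; positivity
  have hX0 : 0 < α₀ * (((L : ℝ) ^ (n + 1))⁻¹) ^ 2 := by positivity
  refine ⟨min (min (ε₀ / (1 + Kρ + KQ)) (α₀ * (((L : ℝ) ^ (n + 1))⁻¹) ^ 2 / 8)) (min (1 / (2 * Mφ * Mφ' * Ck + 1)) (1 / (32 * Ck))),
    by positivity, ?_⟩
  intro U hUG S₁ S₂ ε hε hε₁ hUb hUε hUstar hS₁ hS₂ hS₁n hS₂n Wq C₄ a₃ hW hC₄ ha₃ hWa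
  have hε₁a : ε ≤ ε₀ / (1 + Kρ + KQ) := hε₁.trans ((min_le_left _ _).trans (min_le_left _ _))
  have hε₁d : ε ≤ α₀ * (((L : ℝ) ^ (n + 1))⁻¹) ^ 2 / 8 := hε₁.trans ((min_le_left _ _).trans (min_le_right _ _))
  have hε₁b : ε ≤ 1 / (2 * Mφ * Mφ' * Ck + 1) := hε₁.trans ((min_le_right _ _).trans (min_le_left _ _))
  have hε₁c : ε ≤ 1 / (32 * Ck) := hε₁.trans ((min_le_right _ _).trans (min_le_right _ _))
  -- (52) from the bonds: `pdev(Ũ) ≤ 4ε < α₀L^{−2(n+1)}`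
  have h52 : pdev (perCfg (towerP L m (n + 1)) U) < α₀ * (((L : ℝ) ^ (n + 1))⁻¹) ^ 2 := by
    have hp := pdev_le_of_bonds (V := perCfg (towerP L m (n + 1)) U) (fun x κ => by rw [B9Eq315QTorus.perCfg_apply]; exact hUb _) hε
      (fun x κ => by rw [B9Eq315QTorus.perCfg_apply]; exact hUε _)
    linarith
  -- the level averages: `ε̄`-small (INTENT-6) and in `U1` (leaf-03's Prop. 2 reading)
  have hs : (8 * ((d : ℝ) + 1) * L) ^ (n + 1) * ε ≤ 1 / 32 := by
    rw [← hCkdef]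
    have := (mul_le_mul_of_nonneg_left hε₁c hCk0.le)
    rwa [mul_one_div, mul_comm 32 Ck, ← div_div, div_self hCk0.ne'] at this
  have hUε' : ∀ (j : ℕ) (b : Bond d (towerP L m (j + 1))), ‖(UlevOf L m (n + 1) U j b : 𝔸) - 1‖ ≤ Ck * ε := fun j b => by
    rw [hCkdef]; exact norm_UlevOf_sub_one_le L hL m (n + 1) U hε hUε hs j b
  have hUb' : ∀ (j : ℕ) (b : Bond d (towerP L m (j + 1))), UlevOf L m (n + 1) U j b ∈ U1 𝔸 := fun j b => by
    have h := ulev_mem_U1_of_pdev L m (n + 1) U hL2 hG hUG hα₀ hα3 hα4 h52 j (liftSite b.1) b.2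
    rwa [B9Eq315QTorus.perCfg_apply, perSite_liftSite] at h
  have hαT0 : 0 ≤ αT d L α₀ := by unfold αT; positivity
  have hα2 : ∀ j : ℕ, 50 * ((d : ℝ) + 1) * αT d L α₀ ≤ 1 := fun _ => by
    have hLd : (1 : ℝ) ≤ (L : ℝ) ^ d := one_le_pow₀ hL1
    have : 50 * ((d : ℝ) + 1) * αT d L α₀ ≤ 50 * ((d : ℝ) + 1) * αT d L α₀ * (L : ℝ) ^ d := le_mul_of_one_le_right (by positivity) hLd
    linarith
  have hCkε : 0 ≤ Ck * ε := by positivity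
  -- (ρ′) produced
  have hρ' : ∀ l : SiteL2K ℂ d (towerP L m (n + 1)) c₀ W,
      ‖QprimeTowerW L m n φ U l - QprimeTowerW L m n φ (fun _ : Bond d (towerP L m (n + 1)) => (1 : 𝔸ˣ)) l‖ ≤ Kρ * ε * ‖l‖ := fun l => by
    have h := norm_QprimeTowerW_sub_flat_le L m n (c₀ := c₀) φ hMφ hMφ' hφ hφ' U hCkε hUε' hUb' l
    refine h.trans ?_
    rw [← mul_assoc]
    refine mul_le_mul_of_nonneg_right ?_ (norm_nonneg _)
    -- `(1+x)^N − 1 ≤ N x (1+x)^N ≤ N x 2^N` for `x = 2M_φM_φ′Cᵏε ≤ 1`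
    have hx0 : 0 ≤ 2 * Mφ * Mφ' * (Ck * ε) := by positivity
    have hx1 : 2 * Mφ * Mφ' * (Ck * ε) ≤ 1 := by
      have h1 := mul_le_mul_of_nonneg_left hε₁b (by positivity : (0 : ℝ) ≤ 2 * Mφ * Mφ' * Ck)
      have hfrac : 2 * Mφ * Mφ' * Ck * (1 / (2 * Mφ * Mφ' * Ck + 1)) ≤ 1 := by
        rw [mul_one_div, div_le_one (by positivity)]; linarith
      have hass : 2 * Mφ * Mφ' * (Ck * ε) = 2 * Mφ * Mφ' * Ck * ε := by ring
      rw [hass]; exact h1.trans hfrac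
    have hpow := pow_sub_one_le_mul' hx0 (d * (L - 1) * (n + 1))
    have h2N : (1 + 2 * Mφ * Mφ' * (Ck * ε)) ^ (d * (L - 1) * (n + 1)) ≤ 2 ^ (d * (L - 1) * (n + 1)) :=
      pow_le_pow_left₀ (by positivity) (by linarith) _
    rw [← pow_mul]
    calc ((1 + 2 * Mφ * Mφ' * (Ck * ε)) ^ (d * (L - 1) * (n + 1)) - 1) * (Real.sqrt c₀)⁻¹
        ≤ (((d * (L - 1) * (n + 1) : ℕ) : ℝ) * (2 * Mφ * Mφ' * (Ck * ε)) * (1 + 2 * Mφ * Mφ' * (Ck * ε)) ^ (d * (L - 1) * (n + 1))) * (Real.sqrt c₀)⁻¹ :=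
          mul_le_mul_of_nonneg_right hpow (by positivity)
      _ ≤ (((d * (L - 1) * (n + 1) : ℕ) : ℝ) * (2 * Mφ * Mφ' * (Ck * ε)) * 2 ^ (d * (L - 1) * (n + 1))) * (Real.sqrt c₀)⁻¹ :=
          mul_le_mul_of_nonneg_right (mul_le_mul_of_nonneg_left h2N (by positivity)) (by positivity)
      _ = Kρ * ε := by rw [hKρdef]; ring
  -- (δ_Q) produced
  have hδQ : ∀ x : BondL2K ℂ d (towerP L m (n + 1)) c₀ W,
      ‖QkW L m n φ U hL (fun _ => αT d L α₀) (fun _ => αT_le hL hα4) (ulev_mem_U1_of_pdev L m (n + 1) U hL2 hG hUG hα₀ hα3 hα4 h52)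
            (ulev_reg_of_pdev L m (n + 1) U hL2 hG hUG hα₀ hα3 hα4 h52) (c₁ := c₁) x -
          QkW L m n φ (fun _ : Bond d (towerP L m (n + 1)) => (1 : 𝔸ˣ)) hL (fun _ => 0) (fun _ => by norm_num)
            (perCfg_UlevOf_one_mem_U1 L m (n + 1)) (norm_Wcx_UlevOf_one_sub_one_le L m (n + 1) (fun _ => 0) (fun _ => le_rfl)) (c₁ := c₁) x‖ ≤
        KQ * ε * ‖x‖ := fun x => by
    have h := norm_QkW_sub_flat_le L m n hL φ hMφ hMφ' hφ hφ' (c₀ := c₀) (c₁ := c₁) U (fun _ => αT d L α₀) (fun _ => αT_le hL hα4)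
      (ulev_mem_U1_of_pdev L m (n + 1) U hL2 hG hUG hα₀ hα3 hα4 h52) (ulev_reg_of_pdev L m (n + 1) U hL2 hG hUG hα₀ hα3 hα4 h52) hα2 hCkε hUε' x
    refine h.trans (le_of_eq ?_)
    rw [hKQdef]; ring
  -- the budget `ε + ρ′ + δ_Q ≤ ε₀`
  have hbudget : ε + Kρ * ε + KQ * ε ≤ ε₀ := by
    have h1 : ε + Kρ * ε + KQ * ε = ε * (1 + Kρ + KQ) := by ring
    have h2 : ε * (1 + Kρ + KQ) ≤ ε₀ := by
      have := mul_le_mul_of_nonneg_right hε₁a (by positivity : (0 : ℝ) ≤ 1 + Kρ + KQ)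
      rwa [div_mul_cancel₀ _ (by positivity : (1 + Kρ + KQ) ≠ 0)] at this
    rw [h1]; exact h2
  exact ⟨h52, H U hUG h52 S₁ S₂ hε (by positivity) (by positivity) hbudget hUb hUε hUstar hS₁ hS₂ hS₁n hS₂n hρ' hδQ hW hC₄ ha₃ hWa⟩


end Summit.QuantumFields.BalabanUV.T4Continuum.NE9CurChartTower

end
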